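import Summits.QuantumFields.BalabanUV.T4Continuum.Support.B13Readings
import Summits.QuantumFields.BalabanUV.T4Continuum.Spine.NE2BalabanDecayRate
import Summits.QuantumFields.BalabanUV.T4Continuum.Spine.NE2BalabanFinalRate
import Summits.QuantumFields.BalabanUV.T4Continuum.Support.OutputRateTowerBalaban

/-!
# B13ReadingsDecay — row O4-r: THE TOWER READING OF THE COVARIANCE SPECIES IN THE DECAY CURRENCY OF RECORD
# (entrywise two-run bound against DECAYING format weights from King's (4.38) shape; the Bałaban tier-B instance with ONE
# displayed level-uniform decay binder — the END-OF-RECORD counterpart of `OutputRateTowerBalaban`'s tower road)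

Cell `pub-balaban`, unit `b2b-balaban-t4-ne5-p1` (row NE5 OWNER, gen 33; owner item «g33-b»; O4-r readings are the owner's by the O1
claim table).  Summits-side NEW WORK under the LEAN PLACEMENT RULE (readings = identifications + bookkeeping; print cited for KIND
only).  HONEST FRAMING: rung (B)+1 of the FINITE-VOLUME T⁴ continuum programme — NOT infinite volume, NOT a mass gap, NOT the Clay
problem, NOT a proof of NE5 (NOT PRINTED: the series prints ε-UNIFORM bounds, never η-RATES; GAPS G-t4-U3-1), NOT a proof of NE2 or
NE3.  HONEST DEPENDENCY (cell, verbatim): continuum YM on T⁴ ⇐ BetaPertH ∧ nine spine estimates (0/9 proved); BetaPertH ⇐ (D1) ∧ (D4)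
∧ CAP+tail; G-an2-4 gates asym, D1 and NE2/3/4.

THE CURRENCY QUESTION THIS FILE SETTLES (bookkeeping; no new estimate).  The END OF RECORD (`B13StepEndInsOp.ne5_of_record_insOp`,
`B13AssemblyCoresEnd…`) takes W1 in the ENTRY currency `B13OpDatumJunctions.WeightedEntrywiseRate` against the step's DECAYING entry
formats (B13 (2.16)∕(1.43) weights `e^{−δd(b,b′)}`), species by species (`B13Readings.SpeciesEntryBound`).  `B13Readings` §2 reads a
species typed AS a unit-lattice tower value from row NE2's operator-norm law — but only against a CONSTANT weight on its block
(`towerEntry_rate_of_towerLaw`), and `B13OpDatumJunctions` §1 records why that does not serve the decaying formats (loss `1 ∕ min wt`);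
§3 there reads the covariance species HYPOTHESIS-FREE at `U = 1` from row NE2's entrywise layer (`cov_reading_U1`).  AT A BACKGROUND
nothing entrywise-with-decay existed — until row NE2's sub-row Δ3 «NE2-WALK» (`Support/DecayRateInterpolation`,
`Spine/NE2BalabanDecayRate`): operator-norm rate ∧ level-UNIFORM entry decay ⟹ King's (4.38) two-level shape
`‖(c_{k+1} − c_k)(x,y)‖ ≤ B·θ^k·e^{−δ·dist(x,y)}` (`TwoLevelDecayRate`, rate and decay HALVED).  This file is the NE5 side:

§1 (generic, any family of kernel sequences `c j : ℕ → Matrix n n ℂ` read at index maps `σ t : κ → n`): readings `ReadsTowerCovA`∕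
   `ReadsTowerCovB` (run A's covariance entries at step `k` ARE `c (tow k g U) k (σ t ·) (σ t ·)`, run B's ARE the level `k + 1` of the
   SAME member — the tower road's MI-R), `CovWeightDominatesDist` (the step-`k` format dominates `e^{−δ·dist}` on the covariance block);
   **`cov_formatBy_of_entryDecay`** (one run: level-uniform `EntryDecay … B δ` ⟹ the `SpeciesFormatBy` conjunct, radius `B`) and
   **`cov_entryBound_of_twoLevelDecayRate`** (two runs: `TwoLevelDecayRate … B δ θ` per member ⟹ the `SpeciesEntryBound` conjunct
   `‖rawA.cov − rawB.cov‖ ≤ B·θ^k·wt` — THE DECAY-CURRENCY TOWER READING).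
§2 (Bałaban's typed tier-B operator, rate-generic): for the unit-lattice covariances `pertCovC (P_B(Rg V)) 1 k` of
   `(Δ_a^{(k)} ⊗ 1 + P_B(Rg V)_k)⁻¹` over a datum-indexed family `Rg V` (DATA) in row B5's (3.35)-class, node NE3's `LocalRate … C ρ`
   per member (`L⁻¹ ≤ ρ < 1`, OPEN, displayed), the explicit threshold, and ONE displayed level-uniform decay binder
   `hdec : ∀ V k, EntryDecay dist (pertCovC (P_B(Rg V)) 1 k) B δ` (the printed KIND: [Balaban1985BackgroundPropagators] Thm 3.4 p. 400;
   dictionary B0, asserted by nobody): **`balaban_twoLevelDecayRate_rate`** (PART 4's law ∘ `NE2BalabanDecayRate.decayStations_pertCovC_rate`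
   at `t = 1`: King's shape with `(√(2B·2Cpert∕(1−ρ)), δ∕2, √ρ)`), and the readings' consequences **`cov_formatBy_balaban`** (radius `B`)
   and **`cov_entryBound_balaban_rate`** (`√(2B·2Cpert∕(1−ρ))·(√ρ)^k` against any format dominating `e^{−(δ∕2)·dist}` on the covariance
   block).  So AT THE END OF RECORD the covariance species' W1 conjunct reads: ⇐ NE3 (`LocalRate`, OPEN) ∧ the (3.35)-class ∧ the
   threshold ∧ `hdec` (printed KIND, B0) ∧ the reading — rows NE2's ROOT B ∕ PART 4 ∕ Δ3 consumed BY NAME; input rate `√ρ < 1` (the END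
   of record takes any rate, `B13StepEndInsOp` binder `hθθ′`).  The other four species (`deltaKer`, `gammaConstituent`, `potQ`, `potR`)
   keep their own conjuncts (O4-r: `deltaKer`∕`gammaConstituent` are functions of the same tower member — their readings are the
   substrate's `SubstrateRawSpecies`; `potQ`∕`potR` are functions of `(g k, U)` — Q-S8 (α) — whose two-run rate is a `LocalRate`-type
   input of node NE3's kind, not NE2's).
HONEST: model level (no B0: whether Bałaban's `C^{(k)}(Z₀, σ; U)` entries ARE `pertCovC (P_B(Rg V)) 1 k` read at `σ t` is the substrate's
O1 instance, Q-NE9-O1); statements OURS; NE5 ∕ NE2 ∕ NE3 NOT proved; 0∕12 leaves on Bałaban's concrete objects unchanged; spine 0∕9.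
`FlowStep.BetaPertH`, (B), (B^μ) do not occur.  ABSOLUTE RULE kept; no `def … : Prop` fact (the three `def`s are HYPOTHESIS SHAPES of
readings ∕ format domination, tagged); 0 sorry.
-/

noncomputable section

open scoped BigOperators ComplexConjugate Matrix Matrix.Norms.L2Operator Kronecker

namespace Summit.QuantumFields.BalabanUV.T4Continuum.B13ReadingsDecay

open Summit.QuantumFields.BalabanUV.T4Continuum
open Summit.QuantumFields.BalabanUV.T4Continuum.B13OpDatum
open Summit.QuantumFields.BalabanUV.T4Continuum.B13Readings (SpeciesFormatBy SpeciesEntryBound)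
open Summit.QuantumFields.BalabanUV.T4Continuum.DecayRateInterpolation (EntryDecay TwoLevelDecayRate)
open Literature.MathematicalPhysics.QuantumFieldTheory.Balaban1983to89
open Literature.MathematicalPhysics.QuantumFieldTheory.Balaban1983to89.B5Prop11Plancherel (Cst Cst_nonneg Tor fine)
open Literature.MathematicalPhysics.QuantumFieldTheory.Balaban1983to89.B5G183RateUnitTower (lev lev_neZero)
open Literature.MathematicalPhysics.QuantumFieldTheory.Balaban1983to89.T4EtaRateMin (LocalRate NE3Shape)
open Summit.QuantumFields.BalabanUV.T4Continuum.BalabanAveragedTowerUnit (idx Qlev)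
open Summit.QuantumFields.BalabanUV.T4Continuum.BackgroundResolventTower
open Summit.QuantumFields.BalabanUV.T4Continuum.KingPairingPlantedLaw (calDalev JpcT CJ CJ_nonneg)
open Summit.QuantumFields.BalabanUV.T4Continuum.GramPerturbationLaw (C2gram)
open Summit.QuantumFields.BalabanUV.T4Continuum.NE2FromNE3 (bgReadings)
open Summit.QuantumFields.BalabanUV.T4Continuum.NE2ColourPerturbedLayer (pertCovC)
open Summit.QuantumFields.BalabanUV.T4Continuum.CovariantAveragingSummand (kappaQ kappaQ_ofReal)
open Summit.QuantumFields.BalabanUV.T4Continuum.RegularBackgroundTower (RegularTransporters regClass betaNE3)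
open Summit.QuantumFields.BalabanUV.T4Continuum.GaugeTermScalarData (QuT Q1)
open Summit.QuantumFields.BalabanUV.T4Continuum.RegularSiteTransporters (siteT)
open Summit.QuantumFields.BalabanUV.T4Continuum.NestedContourTransport (theta0)
open Summit.QuantumFields.BalabanUV.T4Continuum.NE2BalabanRoot (balabanPert)
open Summit.QuantumFields.BalabanUV.T4Continuum.NE2BalabanGauge (gaugeSlot liftR)
open Summit.QuantumFields.BalabanUV.T4Continuum.NE2BalabanLayerSharp (kappaBs C2Bs KstarR)
open Summit.QuantumFields.BalabanUV.T4Continuum.NE2BalabanWiring (epsR CdeltaR epsR_nonneg)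
open Summit.QuantumFields.BalabanUV.T4Continuum.NE2BalabanFinal (tauR kappa4F C4F)
open Summit.QuantumFields.BalabanUV.T4Continuum.NE2BalabanThreshold (etaStar smallness_of_le)
open Summit.QuantumFields.BalabanUV.T4Continuum.NE2BalabanFinalRate (perturbationLaws_balaban_final_rate)
open Summit.QuantumFields.BalabanUV.T4Continuum.NE2BalabanDecayRate (decayStations_pertCovC_rate)
open Summit.QuantumFields.BalabanUV.T4Continuum.NE2FromNE3Carrier (ne2Loc)
open Summit.QuantumFields.BalabanUV.T4Continuum.NE2BalabanFromNE3 (localRate_minActReadings_iff)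
open Summit.QuantumFields.BalabanUV.T4Continuum.OutputRateTowerBalaban (norm_one_mul_kappaBs_lt_one_of_regular)
open Summit.QuantumFields.BalabanUV.T4Continuum.MinimalActionRate (minActReadings)

/-! ## §1 The decay-currency tower reading of the covariance species (generic) -/

section Generic

variable {T κ ι Ω 𝒴 Bg J n : Type*}

/-- HYPOTHESIS SHAPE **`ReadsTowerCovA`** (the READING of run A's covariance species on the tower road — an identification, no
inequality): at every step `k` of the window, every slot `t` and entry `(p, q)`, run A's raw covariance entry IS the entry
`(σ t p, σ t q)` of the level-`k` kernel of the member `tow k g U` of the family `c`.  `rfl` for a supplier so defined. [folklore] -/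
@[folklore]
def ReadsTowerCovA (c : J → ℕ → Matrix n n ℂ) (σ : T → κ → n) (tow : ℕ → (ℕ → ℝ) → Bg → J)
    (rawA : (ℕ → ℝ) → Bg → ℕ → RawSpecies T κ ι Ω 𝒴) (W : Set (ℕ → ℝ)) : Prop :=
  ∀ k, ∀ g ∈ W, ∀ (U : Bg) (t : T) (p q : κ), (rawA g U k).cov t p q = c (tow k g U) k (σ t p) (σ t q)

/-- HYPOTHESIS SHAPE **`ReadsTowerCovB`**: run B's raw covariance entry at the paired step IS the entry of the level-`k + 1` kernel
of the SAME member (one more fine level, same background datum read in run A's gauge — the tower road's MI-R). [folklore] -/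
@[folklore]
def ReadsTowerCovB (c : J → ℕ → Matrix n n ℂ) (σ : T → κ → n) (tow : ℕ → (ℕ → ℝ) → Bg → J)
    (rawB : (ℕ → ℝ) → Bg → ℕ → RawSpecies T κ ι Ω 𝒴) (W : Set (ℕ → ℝ)) : Prop :=
  ∀ k, ∀ g ∈ W, ∀ (U : Bg) (t : T) (p q : κ), (rawB g U k).cov t p q = c (tow k g U) (k + 1) (σ t p) (σ t q)

/-- HYPOTHESIS SHAPE (the covariance block of the step-`k` format DOMINATES the decaying weight `e^{−δ·dist}` read through the
slot's index map — e.g. `B13Weights.format` with decay rate `≤ δ` and `d(p, q) ≤ dist (σ t p) (σ t q)`). [folklore] -/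
@[folklore]
def CovWeightDominatesDist (Fk : ℕ → Format (Species T κ ι Ω 𝒴)) (dist : n → n → ℝ) (σ : T → κ → n) (δ : ℝ) : Prop :=
  ∀ (k : ℕ) (t : T) (p q : κ), Real.exp (-(δ * dist (σ t p) (σ t q))) ≤ (Fk k).wt (.cov t p q)

/-- [folklore] **ONE RUN**: level-uniform entry decay `(B, δ)` of every member's kernels + the reading + format domination ⟹ the
covariance conjunct of `SpeciesFormatBy` with radius `B` at every step of the window (the printed KIND of one-run bound, here READ,
not assumed about the format). -/
theorem cov_formatBy_of_entryDecay {Fk : ℕ → Format (Species T κ ι Ω 𝒴)} {c : J → ℕ → Matrix n n ℂ} {σ : T → κ → n}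
    {tow : ℕ → (ℕ → ℝ) → Bg → J} {rawA : (ℕ → ℝ) → Bg → ℕ → RawSpecies T κ ι Ω 𝒴} {W : Set (ℕ → ℝ)}
    {dist : n → n → ℝ} {B δ : ℝ} (hB : 0 ≤ B) (hdec : ∀ j k, EntryDecay dist (c j k) B δ)
    (hread : ReadsTowerCovA c σ tow rawA W) (hdom : CovWeightDominatesDist Fk dist σ δ) (k : ℕ) {g : ℕ → ℝ} (hg : g ∈ W)
    (U : Bg) (t : T) (p q : κ) : ‖(rawA g U k).cov t p q‖ ≤ B * (Fk k).wt (.cov t p q) := by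
  rw [hread k g hg U t p q]
  exact (hdec (tow k g U) k (σ t p) (σ t q)).trans (mul_le_mul_of_nonneg_left (hdom k t p q) hB)

/-- [folklore] **TWO RUNS — THE DECAY-CURRENCY TOWER READING**: King's (4.38) two-level shape `TwoLevelDecayRate dist (c j) B δ θ` for
every member + the two readings + format domination ⟹ the covariance conjunct of `SpeciesEntryBound` with `B·θ^k` at every step of
the window: `‖rawA.cov t p q − rawB.cov t p q‖ ≤ B·θ^k·wt(.cov t p q)` — the two-run η-rate input of W1 OF RECORD for this species,
against DECAYING weights, with NO `1 ∕ min wt` loss. -/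
theorem cov_entryBound_of_twoLevelDecayRate {Fk : ℕ → Format (Species T κ ι Ω 𝒴)} {c : J → ℕ → Matrix n n ℂ}
    {σ : T → κ → n} {tow : ℕ → (ℕ → ℝ) → Bg → J} {rawA rawB : (ℕ → ℝ) → Bg → ℕ → RawSpecies T κ ι Ω 𝒴}
    {W : Set (ℕ → ℝ)} {dist : n → n → ℝ} {B δ θ : ℝ} (hB : 0 ≤ B) (hθ : 0 ≤ θ)
    (hrate : ∀ j, TwoLevelDecayRate dist (c j) B δ θ) (hreadA : ReadsTowerCovA c σ tow rawA W)
    (hreadB : ReadsTowerCovB c σ tow rawB W) (hdom : CovWeightDominatesDist Fk dist σ δ) (k : ℕ) {g : ℕ → ℝ} (hg : g ∈ W)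
    (U : Bg) (t : T) (p q : κ) :
    ‖(rawA g U k).cov t p q - (rawB g U k).cov t p q‖ ≤ B * θ ^ k * (Fk k).wt (.cov t p q) := by
  rw [hreadA k g hg U t p q, hreadB k g hg U t p q, norm_sub_rev, ← Matrix.sub_apply]
  exact (hrate (tow k g U) k (σ t p) (σ t q)).trans
    (mul_le_mul_of_nonneg_left (hdom k t p q) (mul_nonneg hB (pow_nonneg hθ k)))

end Generic

/-! ## §2 The instance for Bałaban's typed tier-B operator, rate-generic, ONE displayed level-uniform decay binder -/

section Balaban

variable {d : ℕ} (L : ℕ) [NeZero L] (M : Fin d → ℕ) [hM : ∀ μ, NeZero (M μ)] (a : ℝ) (ha : 0 < a)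
variable {o : Type*} [Fintype o] [DecidableEq o]
variable {Rg : (k : ℕ) → Fin d → (Tor (fine (lev L k) M) → Matrix o o ℂ)} {α β C ρ a' η : ℝ}

/-- **KING's (4.38) TWO-LEVEL SHAPE FOR BAŁABAN's TYPED TIER-B OPERATOR AT THE PHYSICAL COUPLING, RATE-GENERIC** (`d ≥ 1`,
`L⁻¹ ≤ ρ < 1`): for site-based bond transporters `Rg` (DATA) in row B5's (3.35)-class with sizes `α, β ≤ η ≤ etaStar o d a a′`, node NE3's
`LocalRate … C ρ` (OPEN, displayed), `a′ > 0`, and ONE displayed level-uniform decay binder `hdec` on the unit-lattice covariances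
`pertCovC (P_B(Rg)) 1 k` against any «distance» `dist`:
`‖(pertCovC (P_B Rg) 1 (k+1) − pertCovC (P_B Rg) 1 k)(x,y)‖ ≤ √(2B·2Cpert(κ_B, 2dCst, CJ, C₂^B, 0, 1)∕(1−ρ))·(√ρ)^k·e^{−(δ∕2)·dist(x,y)}` —
PART 4's `perturbationLaws_balaban_final_rate` ∘ `NE2BalabanDecayRate.decayStations_pertCovC_rate` at `t = 1` (`‖1‖κ_B < 1` under the
threshold).  `NE2BalabanDecayRate.balaban_final_decayStations_of_regular` is the case `ρ = L⁻¹`.  Model level (no B0); NE2 ∕ NE3 NOT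
proved. [cite: King1986, Lemma 4.5 (4.38) p.674 (shape); Balaban1985BackgroundPropagators, Thm 3.4 p.400 (the printed kind of `hdec`)] [folklore] -/
theorem balaban_twoLevelDecayRate_rate (hd : 1 ≤ d) (hreg : RegularTransporters L M (liftR L M Rg) α β) (hα : 0 ≤ α) (hβ : 0 ≤ β)
    (hC : 0 ≤ C) (hρ : ((L : ℝ)⁻¹) ≤ ρ) (hρ1 : ρ < 1) (hNE3 : LocalRate (bgReadings L M (regClass L M (liftR L M Rg))) C ρ)
    (ha' : 0 < a') (hαη : α ≤ η) (hβη : β ≤ η) (hη : η ≤ etaStar o d a a')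
    {dist : idx L M 0 × o → idx L M 0 × o → ℝ} {B δ : ℝ}
    (hdec : ∀ k, EntryDecay dist
      (pertCovC L M a ha (balabanPert L M a (liftR L M Rg) (gaugeSlot L M Rg (QuT L M o (siteT L M Rg)) (Q1 L M o) a')) 1 k) B δ) :
    TwoLevelDecayRate dist
      (pertCovC L M a ha (balabanPert L M a (liftR L M Rg) (gaugeSlot L M Rg (QuT L M o (siteT L M Rg)) (Q1 L M o) a')) 1)
      (Real.sqrt (2 * B * (2 *
        Cpert (kappaBs o d a α β (a * (epsR o d α * (2 + epsR o d α) * Cst d a)) (kappa4F d a a' α β)) (2 * d * Cst d a) (CJ d a)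
            (C2Bs o d L a α β C
              (a * C2gram (Cst d a) 1 (epsR o d α) (2 * d * Cst d a) (CJ d a) (Cst d a) (CdeltaR o d a α (theta0 d α (betaNE3 o C))))
              (C4F o d L a a' α β C)) 0 1 / (1 - ρ))))
      (δ / 2) (Real.sqrt ρ) := by
  obtain ⟨h1, h2, -, -, -, -, -, -⟩ := smallness_of_le (o := o) (d := d) a ha.le ha' hα hβ hαη hβη hη
  have hP := perturbationLaws_balaban_final_rate L M a ha hd hreg hC hρ hρ1.le hNE3 ha' h1 h2
  rw [kappaQ_ofReal ha.le] at hP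
  have ht := norm_one_mul_kappaBs_lt_one_of_regular (o := o) (d := d) a ha.le ha' hα hβ hαη hβη hη
  exact (decayStations_pertCovC_rate L M a ha hρ hρ1 hP ht hdec).2.2.2

variable {T κ ι Ω 𝒴 Bg : Type*}

/-- [folklore] **THE COVARIANCE SPECIES OF RECORD AT BAŁABAN's TIER-B BACKGROUND — ONE RUN**: for a datum-indexed family `Rg V`
(`V ∈ dom`, DATA) with the level-uniform decay binder `hdec` per member, a supplier READING run A's covariance entries from the
member `tow k g U` (`ReadsTowerCovA`) and a format dominating `e^{−δ·dist}` on the covariance block, the `SpeciesFormatBy` conjunct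
holds with radius `B`.  (No law is needed for one run: this is `hdec` READ.) -/
theorem cov_formatBy_balaban {dom : Set Bg}
    {RgV : Bg → ((k : ℕ) → Fin d → (Tor (fine (lev L k) M) → Matrix o o ℂ))}
    {Fk : ℕ → Format (Species T κ ι Ω 𝒴)} {σ : T → κ → idx L M 0 × o} {tow : ℕ → (ℕ → ℝ) → Bg → ↥dom}
    {rawA : (ℕ → ℝ) → Bg → ℕ → RawSpecies T κ ι Ω 𝒴} {W : Set (ℕ → ℝ)}
    {dist : idx L M 0 × o → idx L M 0 × o → ℝ} {B δ : ℝ} (hB : 0 ≤ B)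
    (hdec : ∀ V ∈ dom, ∀ k, EntryDecay dist
      (pertCovC L M a ha (balabanPert L M a (liftR L M (RgV V)) (gaugeSlot L M (RgV V) (QuT L M o (siteT L M (RgV V))) (Q1 L M o) a'))
        1 k) B δ)
    (hread : ReadsTowerCovA
      (fun V : ↥dom => pertCovC L M a ha
        (balabanPert L M a (liftR L M (RgV V)) (gaugeSlot L M (RgV V) (QuT L M o (siteT L M (RgV V))) (Q1 L M o) a')) 1)
      σ tow rawA W)
    (hdom : CovWeightDominatesDist Fk dist σ δ) (k : ℕ) {g : ℕ → ℝ} (hg : g ∈ W) (U : Bg) (t : T) (p q : κ) :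
    ‖(rawA g U k).cov t p q‖ ≤ B * (Fk k).wt (.cov t p q) :=
  cov_formatBy_of_entryDecay hB (fun (V : ↥dom) k => hdec V.1 V.2 k) hread hdom k hg U t p q

/-- [folklore] **THE COVARIANCE SPECIES' W1 CONJUNCT OF RECORD AT BAŁABAN's TIER-B BACKGROUND, RATE-GENERIC — TWO RUNS.**  For a
datum-indexed family `Rg V` (`V ∈ dom`, DATA) in the (3.35)-class, node NE3's `LocalRate … C ρ` per member (`L⁻¹ ≤ ρ < 1`; e.g. from ONE
`LocalRate (minActReadings …) C ρ` by `NE2BalabanFromNE3.localRate_minActReadings_iff`), the threshold, `hdec` per member, suppliers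
READING the member `tow k g U` at levels `k` ∕ `k + 1`, and a format dominating `e^{−(δ∕2)·dist}` on the covariance block:
`‖rawA.cov t p q − rawB.cov t p q‖ ≤ √(2B·2Cpert∕(1−ρ))·(√ρ)^k·wt(.cov t p q)` at every step of the window — the `SpeciesEntryBound`
conjunct feeding `hwer` of `B13StepEndInsOp.ne5_of_record_insOp` for this species, at the input rate `√ρ < 1`.  Displayed upstream
binders: NE3 (OPEN), the class, the threshold, `hdec` (printed KIND, B0), the two readings — NOTHING of NE2 type. -/
theorem cov_entryBound_balaban_rate {dom : Set Bg} (hd : 1 ≤ d)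
    {RgV : Bg → ((k : ℕ) → Fin d → (Tor (fine (lev L k) M) → Matrix o o ℂ))}
    (hreg : ∀ V ∈ dom, RegularTransporters L M (liftR L M (RgV V)) α β) (hα : 0 ≤ α) (hβ : 0 ≤ β) (hC : 0 ≤ C)
    (hρ : ((L : ℝ)⁻¹) ≤ ρ) (hρ1 : ρ < 1) (hNE3 : ∀ V ∈ dom, LocalRate (bgReadings L M (regClass L M (liftR L M (RgV V)))) C ρ)
    (ha' : 0 < a') (hαη : α ≤ η) (hβη : β ≤ η) (hη : η ≤ etaStar o d a a')
    {Fk : ℕ → Format (Species T κ ι Ω 𝒴)} {σ : T → κ → idx L M 0 × o} {tow : ℕ → (ℕ → ℝ) → Bg → ↥dom}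
    {rawA rawB : (ℕ → ℝ) → Bg → ℕ → RawSpecies T κ ι Ω 𝒴} {W : Set (ℕ → ℝ)}
    {dist : idx L M 0 × o → idx L M 0 × o → ℝ} {B δ : ℝ}
    (hdec : ∀ V ∈ dom, ∀ k, EntryDecay dist
      (pertCovC L M a ha (balabanPert L M a (liftR L M (RgV V)) (gaugeSlot L M (RgV V) (QuT L M o (siteT L M (RgV V))) (Q1 L M o) a'))
        1 k) B δ)
    (hreadA : ReadsTowerCovA
      (fun V : ↥dom => pertCovC L M a ha
        (balabanPert L M a (liftR L M (RgV V)) (gaugeSlot L M (RgV V) (QuT L M o (siteT L M (RgV V))) (Q1 L M o) a')) 1)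
      σ tow rawA W)
    (hreadB : ReadsTowerCovB
      (fun V : ↥dom => pertCovC L M a ha
        (balabanPert L M a (liftR L M (RgV V)) (gaugeSlot L M (RgV V) (QuT L M o (siteT L M (RgV V))) (Q1 L M o) a')) 1)
      σ tow rawB W)
    (hdom : CovWeightDominatesDist Fk dist σ (δ / 2)) (k : ℕ) {g : ℕ → ℝ} (hg : g ∈ W) (U : Bg) (t : T) (p q : κ) :
    ‖(rawA g U k).cov t p q - (rawB g U k).cov t p q‖ ≤
      Real.sqrt (2 * B * (2 *
        Cpert (kappaBs o d a α β (a * (epsR o d α * (2 + epsR o d α) * Cst d a)) (kappa4F d a a' α β)) (2 * d * Cst d a) (CJ d a)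
            (C2Bs o d L a α β C
              (a * C2gram (Cst d a) 1 (epsR o d α) (2 * d * Cst d a) (CJ d a) (Cst d a) (CdeltaR o d a α (theta0 d α (betaNE3 o C))))
              (C4F o d L a a' α β C)) 0 1 / (1 - ρ))) *
        Real.sqrt ρ ^ k * (Fk k).wt (.cov t p q) :=
  cov_entryBound_of_twoLevelDecayRate (Real.sqrt_nonneg _) (Real.sqrt_nonneg _)
    (fun V : ↥dom => balaban_twoLevelDecayRate_rate L M a ha hd (hreg V.1 V.2) hα hβ hC hρ hρ1 (hNE3 V.1 V.2) ha' hαη hβη hη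
      (hdec V.1 V.2))
    hreadA hreadB hdom k hg U t p q

/-- [folklore] **THE SAME WITH THE FAMILY = THE ADMISSIBLE DATA OF NODE NE3's CARRIER AND NODE U1b's FULL SHAPE** (`dom` = the carrier's
admissible data; ONE binder `NE3Shape (minActReadings d 𝒞 L N dom (ne2Loc L M (liftR ∘ RgV))) C θ`, which carries its own honest rate
`0 ≤ θ < 1`): the covariance conjunct at the input rate `√(max θ L⁻¹) < 1`, constant read at `ρ = max θ L⁻¹`.  No rate binder and no
binder of NE2 type is displayed. -/
theorem cov_entryBound_balaban_ne3Shape {𝒞 : ℕ → Set (B7Prop1Explicit.Site d → Fin d → (Matrix o o ℂ)ˣ)} {N : ℕ}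
    {dom : Set (B7Prop1Explicit.Site d → Fin d → (Matrix o o ℂ)ˣ)} (hL : 2 ≤ L) (hd : 1 ≤ d)
    {RgV : (B7Prop1Explicit.Site d → Fin d → (Matrix o o ℂ)ˣ) → ((k : ℕ) → Fin d → (Tor (fine (lev L k) M) → Matrix o o ℂ))}
    (hreg : ∀ V ∈ dom, RegularTransporters L M (liftR L M (RgV V)) α β) (hα : 0 ≤ α) (hβ : 0 ≤ β) (hC : 0 ≤ C) {θ : ℝ}
    (hNE3 : NE3Shape (minActReadings d 𝒞 L N dom (ne2Loc L M fun V => liftR L M (RgV V))) C θ)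
    (ha' : 0 < a') (hαη : α ≤ η) (hβη : β ≤ η) (hη : η ≤ etaStar o d a a')
    {Fk : ℕ → Format (Species T κ ι Ω 𝒴)} {σ : T → κ → idx L M 0 × o}
    {tow : ℕ → (ℕ → ℝ) → (B7Prop1Explicit.Site d → Fin d → (Matrix o o ℂ)ˣ) → ↥dom}
    {rawA rawB : (ℕ → ℝ) → (B7Prop1Explicit.Site d → Fin d → (Matrix o o ℂ)ˣ) → ℕ → RawSpecies T κ ι Ω 𝒴} {W : Set (ℕ → ℝ)}
    {dist : idx L M 0 × o → idx L M 0 × o → ℝ} {B δ : ℝ}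
    (hdec : ∀ V ∈ dom, ∀ k, EntryDecay dist
      (pertCovC L M a ha (balabanPert L M a (liftR L M (RgV V)) (gaugeSlot L M (RgV V) (QuT L M o (siteT L M (RgV V))) (Q1 L M o) a'))
        1 k) B δ)
    (hreadA : ReadsTowerCovA
      (fun V : ↥dom => pertCovC L M a ha
        (balabanPert L M a (liftR L M (RgV V)) (gaugeSlot L M (RgV V) (QuT L M o (siteT L M (RgV V))) (Q1 L M o) a')) 1)
      σ tow rawA W)
    (hreadB : ReadsTowerCovB
      (fun V : ↥dom => pertCovC L M a ha
        (balabanPert L M a (liftR L M (RgV V)) (gaugeSlot L M (RgV V) (QuT L M o (siteT L M (RgV V))) (Q1 L M o) a')) 1)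
      σ tow rawB W)
    (hdom : CovWeightDominatesDist Fk dist σ (δ / 2)) (k : ℕ) {g : ℕ → ℝ} (hg : g ∈ W)
    (U : B7Prop1Explicit.Site d → Fin d → (Matrix o o ℂ)ˣ) (t : T) (p q : κ) :
    ‖(rawA g U k).cov t p q - (rawB g U k).cov t p q‖ ≤
      Real.sqrt (2 * B * (2 *
        Cpert (kappaBs o d a α β (a * (epsR o d α * (2 + epsR o d α) * Cst d a)) (kappa4F d a a' α β)) (2 * d * Cst d a) (CJ d a)
            (C2Bs o d L a α β C
              (a * C2gram (Cst d a) 1 (epsR o d α) (2 * d * Cst d a) (CJ d a) (Cst d a) (CdeltaR o d a α (theta0 d α (betaNE3 o C))))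
              (C4F o d L a a' α β C)) 0 1 / (1 - max θ ((L : ℝ)⁻¹)))) *
        Real.sqrt (max θ ((L : ℝ)⁻¹)) ^ k * (Fk k).wt (.cov t p q) := by
  have hlt : max θ ((L : ℝ)⁻¹) < 1 :=
    max_lt hNE3.rate_lt_one (inv_lt_one_of_one_lt₀ (by exact_mod_cast (lt_of_lt_of_le one_lt_two hL : 1 < L)))
  exact cov_entryBound_balaban_rate L M a ha hd hreg hα hβ hC (le_max_right _ _) hlt
    (fun V hV => ((localRate_minActReadings_iff L M).1 hNE3.pointwise V hV).mono le_rfl hNE3.rate_nonneg (le_max_left _ _) hC)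
    ha' hαη hβη hη hdec hreadA hreadB hdom k hg U t p q

end Balaban

end Summit.QuantumFields.BalabanUV.T4Continuum.B13ReadingsDecay

end
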